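import Mathlib
import Summits.ValiantsHypothesis.ValiantsHypothesis.Theorems.RigidityForcesSymmetryRankRigidMinimalReprLaplaceFiveStarLemmaKDenominators
import Summits.ValiantsHypothesis.ValiantsHypothesis.Theorems.RigidityForcesSymmetryRankRigidMinimalReprLaplaceFiveStarLemmaKProportionalMinors
import Summits.ValiantsHypothesis.ValiantsHypothesis.Theorems.RigidityForcesSymmetryRankRigidMinimalReprLaplaceFiveStarLemmaKEndgame
import Summits.ValiantsHypothesis.ValiantsHypothesis.Theorems.RigidityForcesSymmetryRankRigidMinimalReprLaplaceFiveStarLemmaKLinearDivisor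
import Summits.ValiantsHypothesis.ValiantsHypothesis.Theorems.RigidityForcesSymmetryRankRigidMinimalReprLaplaceFiveStarLemmaKBinaryCubic
import Summits.ValiantsHypothesis.ValiantsHypothesis.Theorems.RigidityForcesSymmetryRankRigidMinimalReprLaplaceFiveStarLemmaKSquareMemberMain
import Summits.ValiantsHypothesis.ValiantsHypothesis.Theorems.RigidityForcesSymmetryRankRigidMinimalReprLaplaceFiveStarLemmaKCommonFactor

/-!
# ValiantsHypothesis / RigidityForcesSymmetry — crux `LaplaceOptimalFive` (stmt-ValiantsHypothesis-24813), crux idea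
`young-shadow` (K1) on the star: **LEMMA K (the referee's single-cubic lemma), ONE STATEMENT, KERNEL-CHECKED**
(referee note `NOTE-crit3g5-24813-Lemma2prime-elementary.md` §B; memo `NOTE-p4g15-24813-K1-star.md` §12/§14; paper verdict PASS R332)

**LEMMA K.**  Let `Q₁, Q₂` be INDEPENDENT symmetric quadrics on `ℂ⁵` (matrices `U₁, U₂`) and `K` a cubic form (symmetric tensor `W`)
with `dK ∧ dQ₁ ∧ dQ₂ = 0` — all `3 × 3` minors of the Jacobian `[∂K | ∂Q₁ | ∂Q₂]` vanish (✓ `wedge_minors_poly` produces this from the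
exchange identity of a closed two-term star shadow).  Then exactly as in the referee's trichotomy:

(a) the pencil is BINARY — all columns of `U₁, U₂` lie in a plane `⟨e, f⟩` — AND `K ∈ Sym³⟨e,f⟩` (`W` is annihilated by `⟨e,f⟩^⊥`); or
(b) the pencil contains a SQUARE `s U₁ + t U₂ = λλᵀ`, `(s,t) ≠ 0`, AND `K ∈ L·⟨Q₁, Q₂⟩` (`K = L·(c₁Q₁ + c₂Q₂)`, `L = Σ λ_z X_z`); or
(c) `K = 0`.

Assembly (`lemmaK`): a non-zero `2 × 2` minor exists (✓ `proportional_of_parallel` + independence); ✓ `denominator_trichotomy` gives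
(I) polynomial Cramer coefficients ⟹ ✓ `endgame_of_polynomial_coefficients`; (II) proportional minors ⟹ ✓ `binary_of_proportional_minors`;
(III) a linear form divides every minor ⟹ ✓ `square_or_commonFactor_of_linear_divisor`, and a common factor ⟹ ✓ `cubic_of_commonFactor`;
then the «form of `K`» by ✓ `cubic_annihilated_of_binary` / ✓ `cubic_of_square_member`.

No star hypotheses, no definitions, no `sorry`.  Honest framing: this is the Lean price (L2) of the K1-on-the-star theorem — a helper;
it closes NOTHING by itself (the assembly (L3) and the rank bounds (L1) remain); K1-on-the-star is a PAPER theorem (referee PASS);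
`LaplaceOptimalFive` OPEN · CONTESTED 72/120; `VP ≠ VNP` NOT proved.
-/

set_option linter.dupNamespace false

namespace Summit.ValiantsHypothesis.ValiantsHypothesis.Theorems.RigidityForcesSymmetryRankRigidMinimalRepr

namespace LaplaceFiveStar

open Finset MvPolynomial

/-- Independent symmetric `U₁, U₂` have a non-zero Jacobian minor `∂_aQ₁ ∂_cQ₂ − ∂_cQ₁ ∂_aQ₂` (as a polynomial): otherwise
`U₁y ∥ U₂y` for all `y` and ✓ `proportional_of_parallel` makes them proportional. [folklore] -/
theorem exists_minor_ne_zero (U₁ U₂ : Fin 5 → Fin 5 → ℂ)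
    (hU1 : ∀ a b : Fin 5, U₁ a b = U₁ b a) (hU2 : ∀ a b : Fin 5, U₂ a b = U₂ b a)
    (hind : ∀ s t : ℂ, (∀ x w : Fin 5, s * U₁ x w + t * U₂ x w = 0) → s = 0 ∧ t = 0)
    (Q₁ Q₂ : MvPolynomial (Fin 5) ℂ)
    (hQ₁ : Q₁ = ∑ a : Fin 5, ∑ b : Fin 5, C (U₁ a b) * X a * X b)
    (hQ₂ : Q₂ = ∑ a : Fin 5, ∑ b : Fin 5, C (U₂ a b) * X a * X b) :
    ∃ a₀ c₀ : Fin 5, pderiv a₀ Q₁ * pderiv c₀ Q₂ - pderiv c₀ Q₁ * pderiv a₀ Q₂ ≠ 0 := by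
  by_contra hall
  simp only [not_exists, not_not] at hall
  have hpar : ∀ (y : Fin 5 → ℂ) (a c : Fin 5),
      (∑ d : Fin 5, U₁ a d * y d) * (∑ d : Fin 5, U₂ c d * y d) = (∑ d : Fin 5, U₁ c d * y d) * (∑ d : Fin 5, U₂ a d * y d) := by
    intro y a c
    have h := congr_arg (MvPolynomial.eval y) (hall a c)
    rw [map_sub, map_mul, map_mul, map_zero, hQ₁, hQ₂, eval_pderiv_quadric U₁ hU1, eval_pderiv_quadric U₁ hU1,
      eval_pderiv_quadric U₂ hU2, eval_pderiv_quadric U₂ hU2] at h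
    linear_combination h / 4
  have hprop := proportional_of_parallel U₁ U₂ hU1 hU2 hpar
  by_cases hU10 : ∀ c d : Fin 5, U₁ c d = 0
  · exact one_ne_zero (hind 1 0 fun x w => by rw [hU10 x w]; ring).1
  · simp only [not_forall] at hU10
    obtain ⟨c, d, hcd⟩ := hU10
    have h := hind (U₂ c d) (-U₁ c d) fun x w => by linear_combination hprop x w c d
    exact hcd (neg_eq_zero.mp h.2)

/-- **LEMMA K (referee note §B), kernel version.**  `U₁, U₂` independent symmetric, `W` symmetric, `Q_i, K` their forms, all `3 × 3`
minors of `[∂K | ∂Q₁ | ∂Q₂]` zero.  Then (a) BINARY pencil `⊂ Sym²⟨e,f⟩` with `K ∈ Sym³⟨e,f⟩`, or (b) a SQUARE member `λλᵀ` with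
`K = L · (C c₁ Q₁ + C c₂ Q₂)`, or (c) `K = 0`. [folklore] -/
theorem lemmaK (U₁ U₂ : Fin 5 → Fin 5 → ℂ) (W : Fin 5 → Fin 5 → Fin 5 → ℂ)
    (hU1 : ∀ a b : Fin 5, U₁ a b = U₁ b a) (hU2 : ∀ a b : Fin 5, U₂ a b = U₂ b a)
    (hWa : ∀ a b c : Fin 5, W a b c = W b a c) (hWb : ∀ a b c : Fin 5, W a b c = W a c b)
    (hind : ∀ s t : ℂ, (∀ x w : Fin 5, s * U₁ x w + t * U₂ x w = 0) → s = 0 ∧ t = 0)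
    (Q₁ Q₂ K : MvPolynomial (Fin 5) ℂ)
    (hQ₁ : Q₁ = ∑ a : Fin 5, ∑ b : Fin 5, C (U₁ a b) * X a * X b)
    (hQ₂ : Q₂ = ∑ a : Fin 5, ∑ b : Fin 5, C (U₂ a b) * X a * X b)
    (hK : K = ∑ a : Fin 5, ∑ b : Fin 5, ∑ c : Fin 5, C (W a b c) * X a * X b * X c)
    (hT : ∀ a b c : Fin 5,
      pderiv a K * (pderiv b Q₁ * pderiv c Q₂ - pderiv c Q₁ * pderiv b Q₂)
        - pderiv b K * (pderiv a Q₁ * pderiv c Q₂ - pderiv c Q₁ * pderiv a Q₂)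
        + pderiv c K * (pderiv a Q₁ * pderiv b Q₂ - pderiv b Q₁ * pderiv a Q₂) = 0) :
    (∃ e f : Fin 5 → ℂ,
      (∀ d : Fin 5, (∃ s t : ℂ, ∀ x : Fin 5, U₁ x d = s * e x + t * f x) ∧ (∃ s t : ℂ, ∀ x : Fin 5, U₂ x d = s * e x + t * f x)) ∧
      (∀ v : Fin 5 → ℂ, ∑ x : Fin 5, v x * e x = 0 → ∑ x : Fin 5, v x * f x = 0 → ∀ b c : Fin 5, ∑ a : Fin 5, v a * W a b c = 0)) ∨
    (∃ lam : Fin 5 → ℂ, ∃ s t : ℂ, (s ≠ 0 ∨ t ≠ 0) ∧ (∀ x w : Fin 5, s * U₁ x w + t * U₂ x w = lam x * lam w) ∧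
      ∃ c₁ c₂ : ℂ, K = (∑ z : Fin 5, lam z • (X z : MvPolynomial (Fin 5) ℂ)) * (C c₁ * Q₁ + C c₂ * Q₂)) ∨
    K = 0 := by
  classical
  have hK3 : K.IsHomogeneous 3 := by rw [hK]; exact cubic_isHomogeneous W
  obtain ⟨a₀, c₀, h0⟩ := exists_minor_ne_zero U₁ U₂ hU1 hU2 hind Q₁ Q₂ hQ₁ hQ₂
  have hp : ∀ u : Fin 5, (pderiv u Q₁).IsHomogeneous 1 := fun u => by rw [hQ₁]; exact (quadric_isHomogeneous U₁).pderiv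
  have hq : ∀ u : Fin 5, (pderiv u Q₂).IsHomogeneous 1 := fun u => by rw [hQ₂]; exact (quadric_isHomogeneous U₂).pderiv
  -- the structural trichotomy: binary columns ∨ square member ∨ K = 0
  have structural :
      (∃ e f : Fin 5 → ℂ, ∀ d : Fin 5,
        (∃ s t : ℂ, ∀ x : Fin 5, U₁ x d = s * e x + t * f x) ∧ (∃ s t : ℂ, ∀ x : Fin 5, U₂ x d = s * e x + t * f x)) ∨
      (∃ lam : Fin 5 → ℂ, ∃ s t : ℂ, (s ≠ 0 ∨ t ≠ 0) ∧ ∀ x w : Fin 5, s * U₁ x w + t * U₂ x w = lam x * lam w) ∨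
      K = 0 := by
    rcases denominator_trichotomy (fun u => pderiv u K) (fun u => pderiv u Q₁) (fun u => pderiv u Q₂) hp hq hT a₀ c₀ h0
      with ⟨α, β, hI⟩ | hII | ⟨L, hL1, hL0, hIII⟩
    · exact endgame_of_polynomial_coefficients U₁ U₂ W hU1 hU2 hind Q₁ Q₂ K hQ₁ hQ₂ hK a₀ c₀ h0 α β hI
    · choose t ht using hII
      refine Or.inl ⟨fun x => t x c₀, fun x => t x a₀, fun d => ?_⟩
      have hb := fun x => binary_of_proportional_minors U₁ U₂ hU1 hU2 Q₁ Q₂ hQ₁ hQ₂ a₀ c₀ t h0 ht x d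
      exact ⟨⟨U₁ a₀ d, -U₁ c₀ d, fun x => by rw [(hb x).1]; ring⟩, ⟨U₂ a₀ d, -U₂ c₀ d, fun x => by rw [(hb x).2]; ring⟩⟩
    · rcases square_or_commonFactor_of_linear_divisor U₁ U₂ hU1 hU2 hind Q₁ Q₂ hQ₁ hQ₂ L hL1 hL0 hIII with hsq | ⟨l, m₁, m₂, ⟨z₀, hz₀⟩, hcf⟩
      · exact Or.inr (Or.inl hsq)
      · rcases cubic_of_commonFactor U₁ U₂ hind Q₁ Q₂ K hQ₁ hQ₂ hK3 hT l m₁ m₂ z₀ hz₀ hcf with hz | hsq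
        · exact Or.inr (Or.inr hz)
        · exact Or.inr (Or.inl hsq)
  -- the form of `K`
  by_cases hbin : ∃ e f : Fin 5 → ℂ, ∀ d : Fin 5,
      (∃ s t : ℂ, ∀ x : Fin 5, U₁ x d = s * e x + t * f x) ∧ (∃ s t : ℂ, ∀ x : Fin 5, U₂ x d = s * e x + t * f x)
  · obtain ⟨e, f, hcol⟩ := hbin
    exact Or.inl ⟨e, f, hcol, fun v hve hvf b c =>
      cubic_annihilated_of_binary U₁ U₂ W hU1 hU2 hWa hWb Q₁ Q₂ K hQ₁ hQ₂ hK hT a₀ c₀ h0 e f hcol v hve hvf b c⟩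
  · rcases structural with hb | ⟨lam, s, t, hst, hsq⟩ | hz
    · exact absurd hb hbin
    · rcases cubic_of_square_member U₁ U₂ hU1 hU2 hind Q₁ Q₂ K hQ₁ hQ₂ hK3 hT lam s t hst hsq with hform | hb
      · exact Or.inr (Or.inl ⟨lam, s, t, hst, hsq, hform⟩)
      · exact absurd hb hbin
    · exact Or.inr (Or.inr hz)

end LaplaceFiveStar

end Summit.ValiantsHypothesis.ValiantsHypothesis.Theorems.RigidityForcesSymmetryRankRigidMinimalRepr
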